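import Mathlib.RingTheory.Smooth.Basic
import Mathlib.RingTheory.LocalRing.ResidueField.Ideal
import Mathlib.RingTheory.MvPolynomial.Homogeneous
import Mathlib.RingTheory.Localization.FractionRing
import Mathlib.FieldTheory.IntermediateField.Adjoin.Basic
import Literature.RingTheory.HilbertSamuel.ProjDirectrixChart
import HarnessLib

/-!
# [OURS · L1 W4.2] The residue field of the homogeneous prime `𝔭_{x'}` of a chart point is the rational function field
# `κ(x')(Z)`; hence it is formally smooth over `κ(x)` as soon as `κ(x')` is — the input of Theorem IV at every near point
# with separable (formally smooth) residue field extension (campaign s42, cell res-hironaka; `--supports` stmt-ResolutionOfSingularities-17845)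

HONEST FRAMING. OURS (slot W4.2, prover res-L1-s42-pv-1, gen 7). Companion of `…CampaignW42ChartPrimeSeparable` (the separable
ALGEBRAIC case) and `…CampaignW42ThmIVOfFormallySmooth` (Theorem IV at near points whose cone-point residue field `κ(𝔭_{x'})` is
formally smooth over `κ(x)`). Here: for a local homomorphism `φ : A → B`, chart data `u : Fin m → B`, `K = κ(A)`, `L = κ(B)`,
`𝔭 = chartPrime φ u ⊆ K[X_1, …, X_m]` (the forms vanishing at `ū`), an index `i₀` with `ū_{i₀} ≠ 0`, and the hypothesis that `L` is
GENERATED over `K` by the affine coordinates `ū_j/ū_{i₀}` (true for the stalks of a blow-up: `…CampaignW42ThmIVOfFormallySmoothResidue`):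

* `coeff_chartPolyMap` — the `K`-algebra map `Ψ : K[X] → L[Z]`, `X_i ↦ ū_i Z`, has `Z^d`-coefficient `F_d(ū)` (`F_d` the degree-`d`
  component), so **`ker Ψ = 𝔭`** (`chartPolyMap_eq_zero_iff`);
* **`nonempty_algEquiv_residueField_chartPrime_fractionRing`** — `κ(𝔭) ≃ₐ[K] Frac(L[Z])` (the induced map `Frac(S/𝔭) → L(Z)` is onto
  because its range contains the `ū_j/ū_{i₀}`, hence `L`, and `Z`);
* **`formallySmooth_residueField_chartPrime_of_formallySmooth`** — if `L` is formally smooth over `K` (fields: = separable in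
  the sense of EGA, e.g. separably generated), then so is `κ(𝔭)` (`K → L → L[Z] → Frac`).

Pure commutative algebra. NOT a statement of any source (orientation: Nagata's `A_𝔓 = A_{(𝔓)}(T)`, HIO (31.1); Dietel 2015
(9.2.6)). AI-written; AI review is weaker than expert review.
-/

noncomputable section

-- single-conjunct summit: the doubled namespace component `ResolutionOfSingularities` is mandated
set_option linter.dupNamespace false

open IsLocalRing MvPolynomial
open Literature.RingTheory.HilbertSamuel

namespace Summit.ResolutionOfSingularities.ResolutionOfSingularities.Theorems

namespace CampaignW42

universe u v w

/-! ## The map `K[X] → L[Z]`, `X_i ↦ w_i Z`, and its coefficients -/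

section PolyMap

variable {K : Type u} [Field K] {L : Type w} [Field L] [Algebra K L] {m : ℕ}

/-- The `Z^d`-coefficient of `F(w_1 Z, …, w_m Z)` is `F_d(w)`, `F_d` the homogeneous component of degree `d`. [folklore] -/
theorem coeff_aeval_C_mul_X (w : Fin m → L) (f : MvPolynomial (Fin m) K) (d : ℕ) :
    (aeval (fun i => Polynomial.C (w i) * Polynomial.X) f).coeff d = aeval w (homogeneousComponent d f) := by
  classical
  induction f using MvPolynomial.induction_on' with
  | monomial s a =>
    rw [aeval_monomial, homogeneousComponent_of_mem (isHomogeneous_monomial _ rfl)]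
    have hprod : (s.prod fun i e => (Polynomial.C (w i) * Polynomial.X) ^ e) =
        Polynomial.C (s.prod fun i e => w i ^ e) * Polynomial.X ^ s.degree := by
      rw [Finsupp.prod, Finsupp.prod, Finsupp.degree_apply, ← Finset.prod_pow_eq_pow_sum, map_prod,
        ← Finset.prod_mul_distrib]
      refine Finset.prod_congr rfl fun i _ => ?_
      rw [mul_pow, map_pow]
    rw [hprod, ← mul_assoc, Polynomial.algebraMap_apply, ← map_mul, Polynomial.coeff_C_mul_X_pow]
    split_ifs with h
    · subst h
      rw [aeval_monomial]
    · rw [map_zero]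
  | add p q hp hq => rw [map_add, Polynomial.coeff_add, hp, hq, map_add, map_add]

/-- `F(w Z) = 0` iff every homogeneous component of `F` vanishes at `w`. [folklore] -/
theorem aeval_C_mul_X_eq_zero_iff (w : Fin m → L) (f : MvPolynomial (Fin m) K) :
    aeval (fun i => Polynomial.C (w i) * Polynomial.X) f = 0 ↔ ∀ d, aeval w (homogeneousComponent d f) = 0 := by
  rw [Polynomial.ext_iff]
  refine forall_congr' fun d => ?_
  rw [coeff_aeval_C_mul_X, Polynomial.coeff_zero]

end PolyMap

/-! ## `κ(𝔭_{x'}) ≅ κ(x')(Z)` and formal smoothness -/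

section Chart

variable {A : Type u} [CommRing A] [IsLocalRing A] {B : Type u} [CommRing B] [IsLocalRing B]
  (φ : A →+* B) [IsLocalHom φ] {m : ℕ} (u : Fin m → B)

/-- **`ker(K[X] → L[Z], X_i ↦ ū_i Z) = 𝔭_{x'}`** (`𝔭 = chartPrime φ u`, the homogeneous core of the kernel of the chart evaluation:
a polynomial lies in `𝔭` iff all its homogeneous components vanish at `ū`). [folklore] -/
theorem aeval_C_mul_X_eq_zero_iff_mem_chartPrime (f : MvPolynomial (Fin m) (ResidueField A)) :
    letI : Algebra (ResidueField A) (ResidueField B) := (ResidueField.map φ).toAlgebra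
    aeval (fun i => Polynomial.C (residue B (u i)) * Polynomial.X) f = 0 ↔ f ∈ chartPrime φ u := by
  letI : Algebra (ResidueField A) (ResidueField B) := (ResidueField.map φ).toAlgebra
  rw [aeval_C_mul_X_eq_zero_iff]
  constructor
  · intro h
    rw [← sum_homogeneousComponent f]
    refine Ideal.sum_mem _ fun d _ => ?_
    exact (mem_chartPrime_iff_of_isHomogeneous φ u (homogeneousComponent_isHomogeneous d f)).mpr (h d)
  · intro h d
    exact (mem_chartPrime_iff_of_isHomogeneous φ u (homogeneousComponent_isHomogeneous d f)).mp
      (homogeneousComponent_mem_chartPrime φ u h d)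

/-- **`κ(𝔭_{x'}) ≃ κ(x')(Z)` as `κ(x)`-algebras**, when `κ(B)` is generated over `κ(A)` by the affine coordinates `ū_j/ū_{i₀}`
(`ū_{i₀} ≠ 0`): the map `Frac(K[X]/𝔭) → Frac(L[Z])` induced by `X_i ↦ ū_i Z` is a bijection. [folklore] -/
theorem nonempty_algEquiv_residueField_chartPrime_fractionRing (i₀ : Fin m) (hi₀ : X i₀ ∉ chartPrime φ u)
    (hgen : letI : Algebra (ResidueField A) (ResidueField B) := (ResidueField.map φ).toAlgebra
      IntermediateField.adjoin (ResidueField A)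
        (Set.range fun j => residue B (u j) / residue B (u i₀)) = ⊤) :
    letI : Algebra (ResidueField A) (ResidueField B) := (ResidueField.map φ).toAlgebra
    haveI := isPrime_chartPrime φ u
    Nonempty ((chartPrime φ u).ResidueField ≃ₐ[ResidueField A] FractionRing (Polynomial (ResidueField B))) := by
  classical
  letI algKL : Algebra (ResidueField A) (ResidueField B) := (ResidueField.map φ).toAlgebra
  haveI h𝔭 := isPrime_chartPrime φ u
  let K := ResidueField A
  let L := ResidueField B
  let S := MvPolynomial (Fin m) (ResidueField A)
  let 𝔭 : Ideal S := chartPrime φ u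
  let ub : Fin m → L := fun j => residue B (u j)
  have hu₀ : ub i₀ ≠ 0 := by
    intro h
    apply hi₀
    rw [mem_chartPrime_iff_of_isHomogeneous φ u (isHomogeneous_X _ i₀), chartEval_X]
    exact h
  -- `Ψ : S → L[Z]` and the induced injective map `S/𝔭 → L[Z]`
  let Ψ : S →ₐ[K] Polynomial L := aeval fun i => Polynomial.C (ub i) * Polynomial.X
  have hkerΨ : ∀ f : S, Ψ f = 0 ↔ f ∈ 𝔭 := fun f => aeval_C_mul_X_eq_zero_iff_mem_chartPrime φ u f
  let Ψq : (S ⧸ 𝔭) →ₐ[K] Polynomial L :=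
    Ideal.Quotient.liftₐ 𝔭 Ψ fun f hf => (hkerΨ f).mpr hf
  have hΨq_mk : ∀ f : S, Ψq (Ideal.Quotient.mk 𝔭 f) = Ψ f := fun f => rfl
  have hΨq_inj : Function.Injective Ψq := by
    rw [injective_iff_map_eq_zero]
    intro x hx
    obtain ⟨f, rfl⟩ := Ideal.Quotient.mk_surjective x
    rw [hΨq_mk] at hx
    exact Ideal.Quotient.eq_zero_iff_mem.mpr ((hkerΨ f).mp hx)
  -- into the fraction field
  let ι : Polynomial L →ₐ[K] FractionRing (Polynomial L) :=
    IsScalarTower.toAlgHom K (Polynomial L) (FractionRing (Polynomial L))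
  have hι_inj : Function.Injective ι := IsFractionRing.injective (Polynomial L) (FractionRing (Polynomial L))
  let g : (S ⧸ 𝔭) →ₐ[K] FractionRing (Polynomial L) := ι.comp Ψq
  have hg_inj : Function.Injective g := hι_inj.comp hΨq_inj
  let Φ : 𝔭.ResidueField →ₐ[K] FractionRing (Polynomial L) := IsFractionRing.liftAlgHom (K := 𝔭.ResidueField) hg_inj
  have hΦ_mk : ∀ f : S, Φ (algebraMap S 𝔭.ResidueField f) = ι (Ψ f) := by
    intro f
    rw [← Ideal.algebraMap_quotient_residueField_mk, IsFractionRing.liftAlgHom_apply, IsFractionRing.lift_algebraMap]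
    rfl
  -- surjectivity: the field range contains the constants `ū_j/ū_{i₀}`, hence `L`, and `Z`
  have hΦ_surj : Function.Surjective Φ := by
    have hXj : ∀ j, ι (Polynomial.C (ub j) * Polynomial.X) ∈ Φ.fieldRange := fun j =>
      AlgHom.mem_fieldRange.mpr ⟨algebraMap S 𝔭.ResidueField (X j), by rw [hΦ_mk, aeval_X]⟩
    have hCne : ι (Polynomial.C (ub i₀)) ≠ 0 :=
      (map_ne_zero_iff ι hι_inj).mpr (Polynomial.C_ne_zero.mpr hu₀)
    have hCX₀ : ι (Polynomial.C (ub i₀) * Polynomial.X) ≠ 0 := by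
      rw [map_ne_zero_iff ι hι_inj]
      exact mul_ne_zero (Polynomial.C_ne_zero.mpr hu₀) Polynomial.X_ne_zero
    -- the constants lying in the range form an intermediate field containing the generators
    let cL : L →ₐ[K] FractionRing (Polynomial L) := IsScalarTower.toAlgHom K L (FractionRing (Polynomial L))
    have hcL : ∀ l : L, cL l = ι (Polynomial.C l) := fun l => by
      change algebraMap L (FractionRing (Polynomial L)) l = algebraMap (Polynomial L) (FractionRing (Polynomial L)) (Polynomial.C l)
      rw [IsScalarTower.algebraMap_apply L (Polynomial L) (FractionRing (Polynomial L)), Polynomial.algebraMap_eq]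
    let M : IntermediateField K L := (Φ.fieldRange).comap cL
    have hM_mem : ∀ l : L, l ∈ M ↔ ι (Polynomial.C l) ∈ Φ.fieldRange := fun l => by
      change cL l ∈ Φ.fieldRange ↔ _
      rw [hcL]
    have hratio : ∀ j, ub j / ub i₀ ∈ M := by
      intro j
      rw [hM_mem]
      have : ι (Polynomial.C (ub j / ub i₀)) =
          ι (Polynomial.C (ub j) * Polynomial.X) / ι (Polynomial.C (ub i₀) * Polynomial.X) := by
        rw [eq_div_iff hCX₀, ← map_mul]
        congr 1
        rw [mul_left_comm, ← mul_assoc, ← Polynomial.C_mul, mul_div_cancel₀ _ hu₀]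
      rw [this]
      exact div_mem (hXj j) (hXj i₀)
    have hM : M = ⊤ := by
      rw [eq_top_iff, ← hgen]
      exact IntermediateField.adjoin_le_iff.mpr (by rintro _ ⟨j, rfl⟩; exact hratio j)
    have hC : ∀ l : L, ι (Polynomial.C l) ∈ Φ.fieldRange := fun l => by
      rw [← hM_mem, hM]
      exact IntermediateField.mem_top
    have hX : ι Polynomial.X ∈ Φ.fieldRange := by
      have : ι Polynomial.X = ι (Polynomial.C (ub i₀) * Polynomial.X) / ι (Polynomial.C (ub i₀)) := by
        rw [eq_div_iff hCne, ← map_mul, mul_comm]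
      rw [this]
      exact div_mem (hXj i₀) (hC _)
    have hpoly : ∀ q : Polynomial L, ι q ∈ Φ.fieldRange := by
      intro q
      induction q using Polynomial.induction_on' with
      | add p q hp hq => rw [map_add]; exact add_mem hp hq
      | monomial n a =>
        rw [← Polynomial.C_mul_X_pow_eq_monomial, map_mul, map_pow]
        exact mul_mem (hC a) (pow_mem hX n)
    intro z
    obtain ⟨p, q, -, rfl⟩ := IsFractionRing.div_surjective (A := Polynomial L) z
    exact AlgHom.mem_fieldRange.mp (div_mem (hpoly p) (hpoly q))
  exact ⟨AlgEquiv.ofBijective Φ ⟨Φ.toRingHom.injective, hΦ_surj⟩⟩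

/-- **If `κ(B)` is formally smooth over `κ(A)` and generated by the affine coordinates `ū_j/ū_{i₀}`, then `κ(𝔭_{x'})` is
formally smooth over `κ(A)`** (`κ(𝔭) ≅ κ(B)(Z)`; polynomial rings and localizations are formally smooth, and formal
smoothness composes). For FIELDS, formally smooth = separable in the sense of EGA (e.g. separably generated; separable
algebraic; anything over a perfect field in the essentially-finite-type case). [cite: Dietel2015, Prop. (9.2.6) p. 112–113] -/
theorem formallySmooth_residueField_chartPrime_of_formallySmooth (i₀ : Fin m) (hi₀ : X i₀ ∉ chartPrime φ u)
    (hgen : letI : Algebra (ResidueField A) (ResidueField B) := (ResidueField.map φ).toAlgebra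
      IntermediateField.adjoin (ResidueField A)
        (Set.range fun j => residue B (u j) / residue B (u i₀)) = ⊤)
    (hfs : letI : Algebra (ResidueField A) (ResidueField B) := (ResidueField.map φ).toAlgebra
      Algebra.FormallySmooth (ResidueField A) (ResidueField B)) :
    haveI := isPrime_chartPrime φ u
    Algebra.FormallySmooth (ResidueField A) (chartPrime φ u).ResidueField := by
  letI algKL : Algebra (ResidueField A) (ResidueField B) := (ResidueField.map φ).toAlgebra
  haveI h𝔭 := isPrime_chartPrime φ u
  haveI := hfs
  obtain ⟨e⟩ := nonempty_algEquiv_residueField_chartPrime_fractionRing φ u i₀ hi₀ hgen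
  haveI : Algebra.FormallySmooth (Polynomial (ResidueField B)) (FractionRing (Polynomial (ResidueField B))) :=
    Algebra.FormallySmooth.of_isLocalization (nonZeroDivisors (Polynomial (ResidueField B)))
  haveI : Algebra.FormallySmooth (ResidueField B) (FractionRing (Polynomial (ResidueField B))) :=
    Algebra.FormallySmooth.comp (ResidueField B) (Polynomial (ResidueField B)) (FractionRing (Polynomial (ResidueField B)))
  haveI : Algebra.FormallySmooth (ResidueField A) (FractionRing (Polynomial (ResidueField B))) :=
    Algebra.FormallySmooth.comp (ResidueField A) (ResidueField B) (FractionRing (Polynomial (ResidueField B)))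
  exact Algebra.FormallySmooth.of_equiv e.symm

end Chart

end CampaignW42

end Summit.ResolutionOfSingularities.ResolutionOfSingularities.Theorems

end
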